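import Summits.Ventures.CertifiedManyBodySolver.Theorems.TcThermcert1FreeCanonicalCombesThomasPerturbation
import Summits.Ventures.CertifiedManyBodySolver.Theorems.TcThermcert1FreeCanonicalFugacityKernel
import Summits.Ventures.CertifiedManyBodySolver.Theorems.TcThermcert1FreeGasOneBodyDecay
import HarnessLib

/-!
# Free canonical gas at `β·t = 8` — S4: uniform-in-`L` exponential decay of the complex-fugacity Fermi kernel on the good arc

Helper file for route `TcThermcert1` (crux K1′ `ThermalStiffnessCeilingU8b8_le_7o44`, item `stmt-Ventures-24560`), crux idea
`free-canonical-b8-rung` (sketch `Cruxes/ThermalStiffnessCeilingU8b10_le_1o8/FreeCanonicalB8Sketch.lean`, stub S4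
`stub_arcPropagator_decay`; memo `Cruxes/…/FreeCanonicalB8-leafhand-g0.md` §2 "arcKernel_decay").

**S4 (matrix form, the one the two-leg pull-through identity consumes).** Let `h₀ = hubbardOneBody (fermionTorusGraph 2 L) 1 0`
be the free torus one-body matrix, `E = e^{−βh₀}` (positive definite, symmetric, spin-block-diagonal) and `ζ = re^{iφ}` a point of the
fugacity circle on the GOOD ARC `cos φ₀ ≤ cos φ`, `sin φ₀ > 0`. Then `1 + ζE` is invertible, and for every `β ≥ 0`, `R ≥ 0` there are
constants `C, μ > 0` depending only on `(β, R, φ₀)` — NOT on the volume `L`, the radius `r ∈ [0, R]` or the angle — with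

  `|((1 + ζE)⁻¹)_{qk}| ≤ C`   and   `|(ζ (1 + ζE)⁻¹ E)_{qk}| ≤ C · exp(−μ · dist_torus(q, k))`   for all orbitals `q, k`

(`arcKernel_decay`, §2); §3 restates it for the spin blocks `E_σ`, `G'_σ = (1 + ζE_σ)⁻¹` in the exact shape of the hypotheses
`hG'`, `hG''`, `hsymm` of `fugacity_pullThrough_current_twoLeg` (`arcKernel_decay_spinBlock`).

Proof = Combes–Thomas BY CONJUGATION, finite-dimensional throughout (no Fourier analysis, no contour shift), on the generic estimates of
`Theorems/TcThermcert1FreeCanonicalCombesThomasPerturbation.lean`: with the weight `w = μ · dist_torus(·, k)` (`μ`-Lipschitz across the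
hopping bonds of `h₀`, §1) and `ρ_w = diag(e^w)`, the rows and columns of `E_w − E := ρ_wEρ_w⁻¹ − E` have absolute sums at most
`δ(μ) = 4β(e^μ − 1)e^{4βe^μ} ≤ 8βe^{4βe}μ` (`μ ≤ 1`); the Schur test (tree) gives `‖(E_w − E)v‖₂ ≤ δ‖v‖₂`; the resolvent gap
`‖(1 + ζE)v‖₂ ≥ sin φ₀‖v‖₂` (tree) survives the quarter-size perturbation `ζ(E_w − E)` once `Rδ(μ) ≤ sin φ₀/4`, so
`‖(1 + ζE_w)v‖₂ ≥ (sin φ₀/2)‖v‖₂`, hence `|(1 − (1 + ζE_w)⁻¹)_{qk}| ≤ 1 + 2/sin φ₀`; and `1 − (1 + ζE_w)⁻¹ = ρ_w (ζ(1 + ζE)⁻¹E) ρ_w⁻¹`,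
so the tree's `norm_apply_le_of_conj_bound` reads off `|(ζ(1+ζE)⁻¹E)_{qk}| ≤ (1 + 2/sin φ₀) e^{−μ·dist(q,k)}`. The rate
`μ = min(1, sin φ₀/(32βe^{4βe}R + 1))` is absurdly small at `β = 8` but `L`-independent, which is all the rung asks.

HONEST LABEL: finite-dimensional linear algebra about the FREE (`U = 0`) torus gas; a step of a RUNG (`U = 0`, BC5-type witness for the
C8 bet), reach at `U = 8` ZERO; decides nothing about K1/K1′/`T_c`; superconductivity in the Hubbard model is NOT proved or advanced by
this file beyond the rung.
-/

noncomputable section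

namespace Summit.Ventures.CertifiedManyBodySolver.Theorems.TcThermcert1.FreeCanonicalB8

open NormedSpace Matrix Finset
open Literature.MathematicalPhysics.QuantumLattice
open Summit.Ventures.CertifiedManyBodySolver.Theorems.TcThermcert1.FreeGasCurrentClustering
open scoped ComplexOrder ComplexConjugate

/-! ## §1 The torus weight `μ · dist(·, y₀)` is `μ`-Lipschitz across the hopping bonds of `h₀` -/

section Torus

variable (L : ℕ) [NeZero L]

/-- Across a non-zero entry of `h₀` the torus distance to any base point changes by at most `1`. -/
theorem torusDist_sub_le_one_of_hubbardOneBody_ne_zero (y₀ : FermionTorus 2 L) {q k : Orb (FermionTorus 2 L)}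
    (h : hubbardOneBody (fermionTorusGraph 2 L) 1 0 q k ≠ 0) :
    |(torusDist (ofLex q).1.toTorusSite y₀.toTorusSite : ℝ) - (torusDist (ofLex k).1.toTorusSite y₀.toTorusSite : ℝ)| ≤ 1 := by
  have hqk := torusDist_le_one_of_hubbardOneBody_ne_zero L h
  have h1 := torusDist_triangle' (ofLex q).1.toTorusSite (ofLex k).1.toTorusSite y₀.toTorusSite
  have h2 := torusDist_triangle' (ofLex k).1.toTorusSite (ofLex q).1.toTorusSite y₀.toTorusSite
  rw [torusDist_comm' (ofLex k).1.toTorusSite (ofLex q).1.toTorusSite] at h2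
  rw [abs_sub_le_iff]
  constructor
  · have : (torusDist (ofLex q).1.toTorusSite y₀.toTorusSite : ℝ) ≤ (torusDist (ofLex q).1.toTorusSite (ofLex k).1.toTorusSite : ℝ) +
        (torusDist (ofLex k).1.toTorusSite y₀.toTorusSite : ℝ) := by exact_mod_cast h1
    have : (torusDist (ofLex q).1.toTorusSite (ofLex k).1.toTorusSite : ℝ) ≤ 1 := by exact_mod_cast hqk
    linarith
  · have : (torusDist (ofLex k).1.toTorusSite y₀.toTorusSite : ℝ) ≤ (torusDist (ofLex q).1.toTorusSite (ofLex k).1.toTorusSite : ℝ) +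
        (torusDist (ofLex q).1.toTorusSite y₀.toTorusSite : ℝ) := by exact_mod_cast h2
    have : (torusDist (ofLex q).1.toTorusSite (ofLex k).1.toTorusSite : ℝ) ≤ 1 := by exact_mod_cast hqk
    linarith

/-- The weight `w(o) = μ · dist_torus(o, y₀)` is `μ`-Lipschitz across every non-zero entry of `h₀` (`μ ≥ 0`). -/
theorem torusWeight_lipschitz {μ : ℝ} (hμ : 0 ≤ μ) (y₀ : FermionTorus 2 L) (q k : Orb (FermionTorus 2 L))
    (h : hubbardOneBody (fermionTorusGraph 2 L) 1 0 q k ≠ 0) :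
    |μ * (torusDist (ofLex q).1.toTorusSite y₀.toTorusSite : ℝ) - μ * (torusDist (ofLex k).1.toTorusSite y₀.toTorusSite : ℝ)| ≤ μ := by
  rw [← mul_sub, abs_mul, abs_of_nonneg hμ]
  exact (mul_le_mul_of_nonneg_left (torusDist_sub_le_one_of_hubbardOneBody_ne_zero L y₀ h) hμ).trans (le_of_eq (mul_one μ))

/-! ## §2 S4: the complex-fugacity Fermi kernel decays exponentially on the good arc, uniformly in the volume -/

/-- The rate constant: for `0 ≤ μ ≤ 1`, `4β(e^μ − 1)e^{4βe^μ} ≤ 8βe^{4βe}·μ`. -/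
theorem rate_bound {β μ : ℝ} (hβ : 0 ≤ β) (hμ0 : 0 ≤ μ) (hμ1 : μ ≤ 1) :
    ‖(-(β : ℂ))‖ * ((Real.exp μ - 1) * 4) * Real.exp (‖(-(β : ℂ))‖ * (Real.exp μ * 4)) ≤
      8 * β * Real.exp (4 * β * Real.exp 1) * μ := by
  have hnorm : ‖(-(β : ℂ))‖ = β := by rw [norm_neg, Complex.norm_real, Real.norm_of_nonneg hβ]
  rw [hnorm]
  have h1 : Real.exp μ - 1 ≤ 2 * μ := by
    have h := Real.abs_exp_sub_one_le (x := μ) (by rw [abs_of_nonneg hμ0]; exact hμ1)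
    rw [abs_of_nonneg hμ0] at h
    exact (le_abs_self _).trans h
  have h2 : Real.exp (β * (Real.exp μ * 4)) ≤ Real.exp (4 * β * Real.exp 1) := by
    apply Real.exp_le_exp.2
    have := Real.exp_le_exp.2 hμ1
    nlinarith [Real.exp_pos μ]
  have h3 : 0 ≤ Real.exp μ - 1 := by linarith [Real.add_one_le_exp μ]
  calc β * ((Real.exp μ - 1) * 4) * Real.exp (β * (Real.exp μ * 4))
      ≤ β * ((2 * μ) * 4) * Real.exp (4 * β * Real.exp 1) :=
        mul_le_mul (mul_le_mul_of_nonneg_left (mul_le_mul_of_nonneg_right h1 (by norm_num)) hβ) h2 (Real.exp_pos _).le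
          (by positivity)
    _ = 8 * β * Real.exp (4 * β * Real.exp 1) * μ := by ring

/-- **S4 — good-arc decay of the complex-fugacity Fermi kernel, uniform in `L` (orbital form).** For `β ≥ 0`, `R ≥ 0` and a good arc
`cos φ₀ ≤ cos φ` with `sin φ₀ > 0` there are `C, μ > 0` such that for every volume `L`, every radius `0 ≤ r ≤ R` and every such `φ`,
with `E = exp(−β h₀)`, `h₀ = hubbardOneBody (fermionTorusGraph 2 L) 1 0`, `ζ = re^{iφ}`: `1 + ζE` is invertible,
`|((1 + ζE)⁻¹)_{qk}| ≤ C` and `|(ζ(1 + ζE)⁻¹E)_{qk}| ≤ C e^{−μ·dist_torus(q,k)}` for all orbitals `q, k`. -/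
theorem arcKernel_decay (β R φ₀ : ℝ) (hβ : 0 ≤ β) (hR : 0 ≤ R) (hs : 0 < Real.sin φ₀) :
    ∃ C μ : ℝ, 0 < μ ∧ 0 < C ∧ ∀ (L : ℕ) [NeZero L] (r φ : ℝ), 0 ≤ r → r ≤ R → Real.cos φ₀ ≤ Real.cos φ →
      IsUnit (1 + ((r : ℂ) * Complex.exp (Complex.I * φ)) • exp (-((β : ℂ) • hubbardOneBody (fermionTorusGraph 2 L) 1 0))) ∧
      (∀ q k : Orb (FermionTorus 2 L),
        ‖(1 + ((r : ℂ) * Complex.exp (Complex.I * φ)) • exp (-((β : ℂ) • hubbardOneBody (fermionTorusGraph 2 L) 1 0)))⁻¹ q k‖ ≤ C) ∧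
      ∀ q k : Orb (FermionTorus 2 L),
        ‖(((r : ℂ) * Complex.exp (Complex.I * φ)) •
            ((1 + ((r : ℂ) * Complex.exp (Complex.I * φ)) • exp (-((β : ℂ) • hubbardOneBody (fermionTorusGraph 2 L) 1 0)))⁻¹ *
              exp (-((β : ℂ) • hubbardOneBody (fermionTorusGraph 2 L) 1 0)))) q k‖ ≤
          C * Real.exp (-(μ * (torusDist (ofLex q).1.toTorusSite (ofLex k).1.toTorusSite : ℝ))) := by
  set s : ℝ := Real.sin φ₀ with hsdef
  set K : ℝ := Real.exp (4 * β * Real.exp 1) with hK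
  have hK0 : 0 < K := Real.exp_pos _
  set μ : ℝ := min 1 (s / (32 * β * K * R + 1)) with hμdef
  have hden : 0 < 32 * β * K * R + 1 := by positivity
  have hμ0 : 0 < μ := lt_min one_pos (div_pos hs hden)
  have hμ1 : μ ≤ 1 := min_le_left _ _
  have hμ2 : μ ≤ s / (32 * β * K * R + 1) := min_le_right _ _
  -- the perturbation size `δ` and the smallness `R δ ≤ s/4`
  set δ : ℝ := ‖(-(β : ℂ))‖ * ((Real.exp μ - 1) * 4) * Real.exp (‖(-(β : ℂ))‖ * (Real.exp μ * 4)) with hδdef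
  have hδ0 : 0 ≤ δ := by
    have : 0 ≤ Real.exp μ - 1 := by linarith [Real.add_one_le_exp μ]
    positivity
  have hRδ : R * δ ≤ s / 4 := by
    have h1 : δ ≤ 8 * β * K * μ := rate_bound hβ hμ0.le hμ1
    have h2 : R * δ ≤ R * (8 * β * K * μ) := mul_le_mul_of_nonneg_left h1 hR
    have h3 : 8 * β * K * R * μ ≤ 8 * β * K * R * (s / (32 * β * K * R + 1)) := mul_le_mul_of_nonneg_left hμ2 (by positivity)
    have h4 : 8 * β * K * R * (s / (32 * β * K * R + 1)) ≤ s / 4 := by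
      rw [mul_div_assoc', div_le_div_iff₀ hden (by norm_num : (0 : ℝ) < 4)]
      nlinarith [mul_nonneg (mul_nonneg (mul_nonneg (by norm_num : (0 : ℝ) ≤ 8) hβ) hK0.le) hR, hs]
    nlinarith
  refine ⟨1 + 2 / s, μ, hμ0, by positivity, fun L _ r φ hr hrR hφ => ?_⟩
  -- the objects
  set ζ : ℂ := (r : ℂ) * Complex.exp (Complex.I * φ) with hζ
  set h₀ : Matrix (Orb (FermionTorus 2 L)) (Orb (FermionTorus 2 L)) ℂ := hubbardOneBody (fermionTorusGraph 2 L) 1 0 with hh₀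
  have hc : -((β : ℂ) • h₀) = (-(β : ℂ)) • h₀ := (neg_smul _ _).symm
  rw [hc]
  set E : Matrix (Orb (FermionTorus 2 L)) (Orb (FermionTorus 2 L)) ℂ := exp ((-(β : ℂ)) • h₀) with hE
  -- `E` is positive definite
  have hEpd : E.PosDef := by
    have h1 := posDef_gibbsWeight β (isHermitian_hubbardOneBody (fermionTorusGraph 2 L) 1 0)
    rw [gibbsWeight] at h1
    exact h1
  -- the modulus of `ζ`
  have hζnorm : ‖ζ‖ = r := by
    rw [hζ, norm_mul, Complex.norm_real, Real.norm_of_nonneg hr, Complex.norm_exp]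
    simp
  have hζζ : star ζ * ζ = ((r ^ 2 : ℝ) : ℂ) := by
    rw [Complex.star_def, ← Complex.normSq_eq_conj_mul_self, Complex.normSq_eq_norm_sq, hζnorm]
  -- the gap: `s²‖v‖² ≤ ‖(1 + ζE)v‖²`
  have hgap : ∀ v : Orb (FermionTorus 2 L) → ℂ,
      s ^ 2 * (star v ⬝ᵥ v).re ≤ (star ((1 + ζ • E) *ᵥ v) ⬝ᵥ ((1 + ζ • E) *ᵥ v)).re := by
    intro v
    have h : ((Real.sin φ₀ ^ 2 : ℝ) : ℂ) * (star v ⬝ᵥ v) ≤ star ((1 + ζ • E) *ᵥ v) ⬝ᵥ ((1 + ζ • E) *ᵥ v) :=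
      goodArc_resolvent_gap hEpd.posSemidef hr hφ v
    have hV := eq_ofReal_re_of_nonneg (dotProduct_star_self_nonneg v)
    have hW := eq_ofReal_re_of_nonneg (dotProduct_star_self_nonneg ((1 + ζ • E) *ᵥ v))
    rw [hV, hW, ← Complex.ofReal_mul, Complex.real_le_real] at h
    exact h
  have hU : IsUnit (1 + ζ • E) := isUnit_of_lowerBound (by positivity) hgap
  have hUdet : IsUnit (1 + ζ • E).det := (Matrix.isUnit_iff_isUnit_det _).1 hU
  -- entries of the unperturbed inverse
  have hinv0 : ∀ q k, ‖(1 + ζ • E)⁻¹ q k‖ ≤ 1 + 2 / s := by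
    intro q k
    have h1 := norm_inv_apply_sq_le (by positivity : (0 : ℝ) < s ^ 2) hgap q k
    have h2 : ‖(1 + ζ • E)⁻¹ q k‖ ^ 2 ≤ (1 / s) ^ 2 := by rw [div_pow, one_pow]; exact h1
    have h3 : ‖(1 + ζ • E)⁻¹ q k‖ ≤ 1 / s := le_of_pow_le_pow_left₀ two_ne_zero (by positivity) h2
    have h4 : 1 / s ≤ 1 + 2 / s := by
      rw [div_le_iff₀ hs, add_mul, div_mul_cancel₀ _ hs.ne']
      nlinarith
    exact h3.trans h4
  refine ⟨hU, hinv0, fun q k => ?_⟩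
  -- the Combes–Thomas weight based at the column site
  set w : Orb (FermionTorus 2 L) → ℝ := fun o => μ * (torusDist (ofLex o).1.toTorusSite (ofLex k).1.toTorusSite : ℝ) with hw
  have hwL : ∀ x y, h₀ x y ≠ 0 → |w x - w y| ≤ μ := fun x y hxy => torusWeight_lipschitz L hμ0.le (ofLex k).1 x y hxy
  set ρ : Matrix (Orb (FermionTorus 2 L)) (Orb (FermionTorus 2 L)) ℂ := diagonal (fun i => ((Real.exp (w i) : ℝ) : ℂ)) with hρ
  set ρ' : Matrix (Orb (FermionTorus 2 L)) (Orb (FermionTorus 2 L)) ℂ := diagonal (fun i => ((Real.exp (-w i) : ℝ) : ℂ)) with hρ'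
  have hρρ' : ρ * ρ' = 1 := diagonal_exp_mul_diagonal_exp_neg w
  have hρ'ρ : ρ' * ρ = 1 := diagonal_exp_neg_mul_diagonal_exp w
  set Ew : Matrix (Orb (FermionTorus 2 L)) (Orb (FermionTorus 2 L)) ℂ := ρ * E * ρ' with hEw
  -- row and column sums of `E_w − E`
  have hrows : ∀ x, ∑ y, ‖(Ew - E) x y‖ ≤ δ := fun x =>
    sum_norm_conj_exp_sub_exp_row_le w h₀ (-(β : ℂ)) hμ0.le (sum_norm_hubbardOneBody_torus_le L) hwL x
  have hcols : ∀ y, ∑ x, ‖(Ew - E) x y‖ ≤ δ := fun y =>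
    sum_norm_conj_exp_sub_exp_col_le w h₀ (hubbardOneBody_torus_transpose L) (-(β : ℂ)) hμ0.le
      (sum_norm_hubbardOneBody_torus_le L) hwL y
  -- the perturbation `B = ζ(E_w − E)` is quarter-size
  have hB : ∀ v : Orb (FermionTorus 2 L) → ℂ,
      (star ((ζ • (Ew - E)) *ᵥ v) ⬝ᵥ ((ζ • (Ew - E)) *ᵥ v)).re ≤ s ^ 2 / 16 * (star v ⬝ᵥ v).re := by
    intro v
    have h1 := schur_test (Ew - E) hrows hcols v
    have hV : 0 ≤ (star v ⬝ᵥ v).re := (Complex.nonneg_iff.1 (dotProduct_star_self_nonneg v)).1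
    have h2 : (star ((ζ • (Ew - E)) *ᵥ v) ⬝ᵥ ((ζ • (Ew - E)) *ᵥ v)).re =
        r ^ 2 * (star ((Ew - E) *ᵥ v) ⬝ᵥ ((Ew - E) *ᵥ v)).re := by
      rw [Matrix.smul_mulVec, star_smul, smul_dotProduct, dotProduct_smul, smul_smul, hζζ, smul_eq_mul, Complex.re_ofReal_mul]
    rw [h2]
    have h3 : r ^ 2 * (δ * δ) ≤ s ^ 2 / 16 := by
      have : r * δ ≤ s / 4 := (mul_le_mul_of_nonneg_right hrR hδ0).trans hRδ
      have h0 : 0 ≤ r * δ := mul_nonneg hr hδ0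
      nlinarith
    have hW : 0 ≤ (star ((Ew - E) *ᵥ v) ⬝ᵥ ((Ew - E) *ᵥ v)).re := (Complex.nonneg_iff.1 (dotProduct_star_self_nonneg _)).1
    nlinarith [mul_le_mul_of_nonneg_right h3 hV, sq_nonneg r]
  -- hence the conjugated resolvent has the lower bound `s²/4`
  have hsum : 1 + ζ • E + ζ • (Ew - E) = 1 + ζ • Ew := by rw [smul_sub]; abel
  have hgapw : ∀ v : Orb (FermionTorus 2 L) → ℂ,
      s ^ 2 / 4 * (star v ⬝ᵥ v).re ≤ (star ((1 + ζ • Ew) *ᵥ v) ⬝ᵥ ((1 + ζ • Ew) *ᵥ v)).re := by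
    intro v
    have h := lowerBound_add_of_small hgap hB v
    rwa [hsum] at h
  have hUw : IsUnit (1 + ζ • Ew) := isUnit_of_lowerBound (by positivity) hgapw
  have hUwdet : IsUnit (1 + ζ • Ew).det := (Matrix.isUnit_iff_isUnit_det _).1 hUw
  -- entries of `1 − (1 + ζE_w)⁻¹`
  have hinvw : ‖(1 - (1 + ζ • Ew)⁻¹) q k‖ ≤ 1 + 2 / s := by
    have h1 := norm_inv_apply_sq_le (by positivity : (0 : ℝ) < s ^ 2 / 4) hgapw q k
    have h2 : ‖(1 + ζ • Ew)⁻¹ q k‖ ^ 2 ≤ (2 / s) ^ 2 := by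
      rw [div_pow]; rw [one_div_div] at h1; linarith
    have h3 : ‖(1 + ζ • Ew)⁻¹ q k‖ ≤ 2 / s := le_of_pow_le_pow_left₀ two_ne_zero (by positivity) h2
    rw [Matrix.sub_apply]
    refine (norm_sub_le _ _).trans (add_le_add ?_ h3)
    rw [Matrix.one_apply]
    split_ifs <;> simp
  -- the conjugation identity `ρ (ζ(1+ζE)⁻¹E) ρ⁻¹ = 1 − (1 + ζE_w)⁻¹`
  have hker : ζ • ((1 + ζ • E)⁻¹ * E) = 1 - (1 + ζ • E)⁻¹ := by
    have h1 : (1 + ζ • E)⁻¹ * (1 + ζ • E) = 1 := Matrix.nonsing_inv_mul _ hUdet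
    rw [Matrix.mul_add, Matrix.mul_one, Matrix.mul_smul] at h1
    rw [eq_sub_iff_add_eq, add_comm]
    exact h1
  have hinvconj : (1 + ζ • Ew)⁻¹ = ρ * (1 + ζ • E)⁻¹ * ρ' := by
    refine Matrix.inv_eq_left_inv ?_
    have h1 : 1 + ζ • Ew = ρ * (1 + ζ • E) * ρ' := by
      rw [hEw, Matrix.mul_add, Matrix.add_mul, Matrix.mul_one, hρρ', Matrix.mul_smul, Matrix.smul_mul]
    rw [h1]
    calc ρ * (1 + ζ • E)⁻¹ * ρ' * (ρ * (1 + ζ • E) * ρ') = ρ * (1 + ζ • E)⁻¹ * (ρ' * ρ) * (1 + ζ • E) * ρ' := by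
          simp only [Matrix.mul_assoc]
      _ = ρ * ((1 + ζ • E)⁻¹ * (1 + ζ • E)) * ρ' := by rw [hρ'ρ, Matrix.mul_one]; simp only [Matrix.mul_assoc]
      _ = 1 := by rw [Matrix.nonsing_inv_mul _ hUdet, Matrix.mul_one, hρρ']
  have hconj : ρ * (ζ • ((1 + ζ • E)⁻¹ * E)) * ρ' = 1 - (1 + ζ • Ew)⁻¹ := by
    rw [hker, Matrix.mul_sub, Matrix.sub_mul, Matrix.mul_one, hρρ', hinvconj]
  -- read off the decay
  have hbound : ‖(ρ * (ζ • ((1 + ζ • E)⁻¹ * E)) * ρ') q k‖ ≤ 1 + 2 / s := by rw [hconj]; exact hinvw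
  have hfinal := norm_apply_le_of_conj_bound w (ζ • ((1 + ζ • E)⁻¹ * E)) q k hbound
  have hwk : w k = 0 := by
    show μ * (torusDist (ofLex k).1.toTorusSite (ofLex k).1.toTorusSite : ℝ) = 0
    rw [torusDist_self, Nat.cast_zero, mul_zero]
  rw [hwk, zero_sub] at hfinal
  exact hfinal

end Torus

/-! ## §3 Spin blocks: S4 in the shape consumed by `fugacity_pullThrough_current_twoLeg` -/

section SpinBlock

variable {Λ : Type*} [LinearOrder Λ] [Fintype Λ]

omit [LinearOrder Λ] in
/-- The spin-`σ` block of a product `M N` with `N` spin-block-diagonal is the product of the spin-`σ` blocks. -/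
theorem spinBlock_mul_apply (M N : Matrix (Orb Λ) (Orb Λ) ℂ) (σ : Fin 2)
    (hN : ∀ q k : Orb Λ, (ofLex q).2 ≠ (ofLex k).2 → N q k = 0) (x y : Λ) :
    (Matrix.of (fun x y : Λ => M (orb x σ) (orb y σ)) * Matrix.of (fun x y : Λ => N (orb x σ) (orb y σ))) x y =
      (M * N) (orb x σ) (orb y σ) := by
  rw [Matrix.mul_apply, Matrix.mul_apply, sum_orb_eq_sum_sum]
  refine Finset.sum_congr rfl fun z _ => ?_
  simp only [Matrix.of_apply]
  rw [Finset.sum_eq_single σ]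
  · intro τ _ hτ
    rw [hN (orb z τ) (orb y σ) (by rw [ofLex_orb, ofLex_orb]; exact hτ), mul_zero]
  · intro h
    exact absurd (Finset.mem_univ σ) h

end SpinBlock

section TorusSpinBlock

variable (L : ℕ) [NeZero L]

/-- **S4 — spin-block form.** For `β ≥ 0`, `R ≥ 0`, a good arc `cos φ₀ ≤ cos φ` with `sin φ₀ > 0`: there are `C, μ > 0` such that for
every volume `L`, every `0 ≤ r ≤ R`, every such `φ`, each spin `σ` and the spin-`σ` block `E_σ` of `e^{−βh₀}` (characterised entrywise, as
in `fugacity_pullThrough_current_twoLeg`), with `ζ = re^{iφ}` and `G' = (1 + ζE_σ)⁻¹`: `G'(1 + ζE_σ) = 1`, `G'(1 + ζE_σᵀ) = 1`, the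
kernel `ζG'E_σ` is a symmetric matrix, `|G'_{xy}| ≤ C`, and `|(ζG'E_σ)_{xy}| ≤ C e^{−μ·dist_torus(x,y)}` — the hypotheses `hG'`, `hG''`,
`hsymm` of the two-leg identity together with the norm control that identity was waiting for, uniformly in `L`. -/
theorem arcKernel_decay_spinBlock (β R φ₀ : ℝ) (hβ : 0 ≤ β) (hR : 0 ≤ R) (hs : 0 < Real.sin φ₀) :
    ∃ C μ : ℝ, 0 < μ ∧ 0 < C ∧ ∀ (L : ℕ) [NeZero L] (r φ : ℝ), 0 ≤ r → r ≤ R → Real.cos φ₀ ≤ Real.cos φ → ∀ (σ : Fin 2)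
      (Eσ : Matrix (FermionTorus 2 L) (FermionTorus 2 L) ℂ),
      (∀ x y, Eσ x y = (exp (-((β : ℂ) • hubbardOneBody (fermionTorusGraph 2 L) 1 0))) (orb x σ) (orb y σ)) →
        (1 + ((r : ℂ) * Complex.exp (Complex.I * φ)) • Eσ)⁻¹ * (1 + ((r : ℂ) * Complex.exp (Complex.I * φ)) • Eσ) = 1 ∧
        (1 + ((r : ℂ) * Complex.exp (Complex.I * φ)) • Eσ)⁻¹ * (1 + ((r : ℂ) * Complex.exp (Complex.I * φ)) • Eσᵀ) = 1 ∧
        (∀ a b, (((r : ℂ) * Complex.exp (Complex.I * φ)) • ((1 + ((r : ℂ) * Complex.exp (Complex.I * φ)) • Eσ)⁻¹ * Eσ)) a b =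
          (((r : ℂ) * Complex.exp (Complex.I * φ)) • ((1 + ((r : ℂ) * Complex.exp (Complex.I * φ)) • Eσ)⁻¹ * Eσ)) b a) ∧
        (∀ x y, ‖(1 + ((r : ℂ) * Complex.exp (Complex.I * φ)) • Eσ)⁻¹ x y‖ ≤ C) ∧
        ∀ x y, ‖(((r : ℂ) * Complex.exp (Complex.I * φ)) • ((1 + ((r : ℂ) * Complex.exp (Complex.I * φ)) • Eσ)⁻¹ * Eσ)) x y‖ ≤
          C * Real.exp (-(μ * (torusDist x.toTorusSite y.toTorusSite : ℝ))) := by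
  obtain ⟨C, μ, hμ, hC, hmain⟩ := arcKernel_decay β R φ₀ hβ hR hs
  refine ⟨C, μ, hμ, hC, fun L _ r φ hr hrR hφ σ Eσ hEσ => ?_⟩
  obtain ⟨hU, hinv, hdec⟩ := hmain L r φ hr hrR hφ
  set ζ : ℂ := (r : ℂ) * Complex.exp (Complex.I * φ) with hζ
  set h₀ : Matrix (Orb (FermionTorus 2 L)) (Orb (FermionTorus 2 L)) ℂ := hubbardOneBody (fermionTorusGraph 2 L) 1 0 with hh₀
  have hc : -((β : ℂ) • h₀) = (-(β : ℂ)) • h₀ := (neg_smul _ _).symm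
  rw [hc] at hU hinv hdec hEσ
  set E : Matrix (Orb (FermionTorus 2 L)) (Orb (FermionTorus 2 L)) ℂ := exp ((-(β : ℂ)) • h₀) with hE
  have hUdet : IsUnit (1 + ζ • E).det := (Matrix.isUnit_iff_isUnit_det _).1 hU
  -- structure of `E`: spin-block-diagonal and symmetric
  have hEspin : ∀ q k : Orb (FermionTorus 2 L), (ofLex q).2 ≠ (ofLex k).2 → E q k = 0 := fun q k hqk =>
    exp_smul_hubbardOneBody_apply_of_spin_ne L (-(β : ℂ)) hqk
  have hEsymm : ∀ q k : Orb (FermionTorus 2 L), E q k = E k q := fun q k => exp_smul_hubbardOneBody_apply_comm L (-(β : ℂ)) q k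
  have hAspin : ∀ q k : Orb (FermionTorus 2 L), (ofLex q).2 ≠ (ofLex k).2 → (1 + ζ • E) q k = 0 := by
    intro q k hqk
    have hne : q ≠ k := fun h => hqk (by rw [h])
    rw [Matrix.add_apply, Matrix.one_apply_ne hne, Matrix.smul_apply, hEspin q k hqk, smul_zero, add_zero]
  have hEσt : Eσᵀ = Eσ := by
    ext x y
    rw [transpose_apply, hEσ, hEσ, hEsymm]
  -- the spin block of the orbital inverse is a left inverse of `1 + ζE_σ`
  have hEσ_of : Matrix.of (fun x y : FermionTorus 2 L => E (orb x σ) (orb y σ)) = Eσ := by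
    ext x y; rw [Matrix.of_apply, hEσ]
  have hA_of : Matrix.of (fun x y : FermionTorus 2 L => (1 + ζ • E) (orb x σ) (orb y σ)) = 1 + ζ • Eσ := by
    ext x y
    rw [Matrix.of_apply, Matrix.add_apply, Matrix.add_apply, Matrix.smul_apply, Matrix.smul_apply, hEσ, Matrix.one_apply,
      Matrix.one_apply]
    by_cases hxy : x = y
    · rw [if_pos hxy, if_pos (by rw [hxy])]
    · rw [if_neg hxy, if_neg (fun h => hxy (orb_inj.1 h).1)]
  set Bσ : Matrix (FermionTorus 2 L) (FermionTorus 2 L) ℂ := Matrix.of (fun x y : FermionTorus 2 L => (1 + ζ • E)⁻¹ (orb x σ) (orb y σ))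
    with hBσ
  have hleft : Bσ * (1 + ζ • Eσ) = 1 := by
    rw [← hA_of]
    ext x y
    rw [hBσ, spinBlock_mul_apply _ _ σ hAspin, Matrix.nonsing_inv_mul _ hUdet, Matrix.one_apply, Matrix.one_apply]
    by_cases hxy : x = y
    · rw [if_pos hxy, if_pos (by rw [hxy])]
    · rw [if_neg hxy, if_neg (fun h => hxy (orb_inj.1 h).1)]
  have hinvσ : (1 + ζ • Eσ)⁻¹ = Bσ := Matrix.inv_eq_left_inv hleft
  -- the kernel's spin block
  have hker : ∀ x y, ((1 + ζ • Eσ)⁻¹ * Eσ) x y = ((1 + ζ • E)⁻¹ * E) (orb x σ) (orb y σ) := by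
    intro x y
    rw [hinvσ, ← hEσ_of, hBσ, spinBlock_mul_apply _ _ σ hEspin]
  -- symmetry of the orbital inverse (from the symmetry of `E`)
  have hAt : (1 + ζ • E)ᵀ = 1 + ζ • E := by
    ext q k
    rw [transpose_apply, Matrix.add_apply, Matrix.add_apply, Matrix.smul_apply, Matrix.smul_apply, hEsymm, Matrix.one_apply,
      Matrix.one_apply]
    by_cases hqk : q = k
    · rw [if_pos hqk, if_pos hqk.symm]
    · rw [if_neg hqk, if_neg (Ne.symm hqk)]
  have hGt : ∀ q k, (1 + ζ • E)⁻¹ q k = (1 + ζ • E)⁻¹ k q := by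
    intro q k
    have h := transpose_nonsing_inv (1 + ζ • E)
    rw [hAt] at h
    have := congrFun (congrFun h k) q
    rw [transpose_apply] at this
    exact this
  have hKt : ∀ q k, ((1 + ζ • E)⁻¹ * E) q k = ((1 + ζ • E)⁻¹ * E) k q := by
    intro q k
    have hk0 : ζ • ((1 + ζ • E)⁻¹ * E) = 1 - (1 + ζ • E)⁻¹ := by
      have h1 : (1 + ζ • E)⁻¹ * (1 + ζ • E) = 1 := Matrix.nonsing_inv_mul _ hUdet
      rw [Matrix.mul_add, Matrix.mul_one, Matrix.mul_smul] at h1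
      rw [eq_sub_iff_add_eq, add_comm]
      exact h1
    by_cases hζ0 : ζ = 0
    · have : (1 + ζ • E)⁻¹ = 1 := by rw [hζ0, zero_smul, add_zero, inv_one]
      rw [this, Matrix.one_mul, hEsymm]
    · have h := congrFun (congrFun hk0 q) k
      have h' := congrFun (congrFun hk0 k) q
      simp only [Matrix.smul_apply, smul_eq_mul, Matrix.sub_apply] at h h'
      have e : ζ * ((1 + ζ • E)⁻¹ * E) q k = ζ * ((1 + ζ • E)⁻¹ * E) k q := by
        rw [h, h', hGt q k, Matrix.one_apply, Matrix.one_apply]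
        by_cases hqk : q = k
        · rw [if_pos hqk, if_pos hqk.symm]
        · rw [if_neg hqk, if_neg (Ne.symm hqk)]
      exact mul_left_cancel₀ hζ0 e
  refine ⟨by rw [hinvσ]; exact hleft, by rw [hEσt, hinvσ]; exact hleft, fun a b => ?_, fun x y => ?_, fun x y => ?_⟩
  · rw [Matrix.smul_apply, Matrix.smul_apply, hker, hker, hKt]
  · rw [hinvσ, hBσ, Matrix.of_apply]
    exact hinv _ _
  · have h := hdec (orb x σ) (orb y σ)
    rw [Matrix.smul_apply, smul_eq_mul] at h
    rw [Matrix.smul_apply, smul_eq_mul, hker]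
    exact h

end TorusSpinBlock

end Summit.Ventures.CertifiedManyBodySolver.Theorems.TcThermcert1.FreeCanonicalB8

end
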